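import Summits.QuantumFields.YangMills.Theorems.FluctuationComparisonRegPrIntLOrganTangentChiOfReadDwhite
import HarnessLib

/-!
# Crux `FluctuationComparisonRegPrIntL` (stmt-QuantumFields-20520, rung R3), PATH-B organ (covariant organ of record, RULING №56) — (L54) «THE FRAME'S CHART LETTERS FROM THE D0
# PRIMITIVES»: ✓p823910's two frame letters about the chart — `hcont` («`V ↦ J(V,z)·f(Φ(V,z))` is continuous on the `θ_j`-window for every continuous `f`») and `hJle`
# («`J ≤ CJ`») — FROM the structure letters (Φw), (Jfac), (χ-read) and CONTINUITY ON THE WINDOW of the three D0 primitives `V ↦ Amin V`, `V ↦ Wh V z`, `V ↦ cJ V`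
# (+ a global bound `|cJ| ≤ Cc`); conclusions = the two binder texts VERBATIM

Cell `ym3-torus` (YM ladder rung R3 = continuum `SU(2)` Yang–Mills on the three-torus — a RUNG: NOT d = 4, NOT infinite volume, NOT a mass gap, NOT Clay).
Width seat `ym-ust-20520-w5` (gen 26), `--kind proof --supports stmt-QuantumFields-20520 --as helper`, count-neutral, DEFINITION-FREE, default heartbeats,
no registry ∕ binder ∕ `Lines/` edit.  Over ✓p828570 `…OrganTangentHaarFactorLipOfDwhite` (`haarFactor_mem_Icc`), lit `T4CubeChartExp` (`continuous_expPt`, `toE`), Mathlib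
(`continuousOn_pi`, `ContinuousOn.mul`, `continuousOn_finsetProd`, `Real.continuous_sinc`).

WHY.  REG′ (✓p823910 `weightLip_of_beta_of_incr` ∕ `ilawRegX∕V3∕Sq_of_beta_of_incr`) carries, besides (β)×2, (I-geo)sq and the two chart-side letters now docked on D0's primitives
(✓(L50b) ✓(L52) ✓(L53)), two FRAME letters that are themselves statements about the chart: `hcont` and `hJle`.  With the structure letters (Φw) `Φ(V,z) e = Amin V e·expPt(Wh V z e)`,
(Jfac) `J = cJ·χ`, (χ-read) `χ V z = Π_{e∈S} sinc²‖toE (Wh V z e)‖`, both follow from plain continuity of the primitives on the window (and `|cJ| ≤ Cc` globally for `hJle`, since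
`χ ∈ [0,1]` everywhere): `expPt`, the group product, `sinc²∘‖toE ·‖` and finite products are continuous.
INHABITATION (★★OWNER RULING №100): LAW-FREE — topology of the chart objects pointwise in `z`; no fibre law, no score.

WHAT.  §1 ★`phi_continuousOn_of_primitives` — (Φw) + `ContinuousOn Amin W` + `∀ z, ContinuousOn (V ↦ Wh V z) W` ⟹ `∀ z, ContinuousOn (V ↦ Φ (V,z)) W`;
★`jac_continuousOn_of_primitives` — (Jfac) + (χ-read) + `ContinuousOn cJ W` + `ContinuousOn (V ↦ Wh V z) W` ⟹ `ContinuousOn (V ↦ (J (V,z) : ℝ)) W`.  §2 ★★`hJle_of_primitives` —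
(Jfac) + (χ-read) + `∀ V, |cJ V| ≤ Cc` ⟹ ✓p823910's `hJle` text with `CJ := Cc`; ★★★`hcont_of_primitives` — ✓p823910's `hcont` binder text VERBATIM ⟸ (Φw) + (Jfac) + (χ-read) +
the three continuities on `{V | PlaqSmall θ_j V}` (the MW-support premise on `f` is not even used).  NET: REG′'s frame letters `hcont`∕`hJle` join `hPJ hPincr hSJ hSincr` as
consequences of D0's primitives {`Amin`, `Wh`, `cJ` continuous on the window; (Φw), (Jfac), (χ-read)}.

HONEST FRAMING: topology [folklore] over HYPOTHESIS structure letters; the primitives' continuity, (Φw), (Jfac), (χ-read) are D0's content (crux 19200 EX ∧ V2′) and NOT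
proved here; nothing of Bałaban's analysis is asserted or proved; (Dmin), (W-·) letters, (I-curv), (I-cov), KER′ letters, rows v0.1–v0.4 UNDISCHARGED; the five registered stubs
of `Lines/semiclassical_s2beta.lean`, crux 20520 and `YM3TorusSU2` are NOT proved; registry untouched; rung R3 = SU(2) YM₃ on T³ — NOT d = 4, NOT infinite volume, NOT a mass
gap, NOT Clay; the Yang–Mills mass gap is NOT proved.  [folklore]
-/

set_option autoImplicit false

noncomputable section

namespace Summit.QuantumFields.YangMills.Theorems.OrganTangentFrameLettersOfD0Primitives

open Function Set Finset
open scoped NNReal BigOperators Topology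
open Literature.MathematicalPhysics.QuantumFieldTheory
open Literature.MathematicalPhysics.QuantumFieldTheory.Balaban1983to89 T3ContinuumYM3Torus T3NestedUnitLaws
  T3UnitLawDensityEML T4Continuum BalabanUVClass T3UnitScaleTilt T3LevelShift T3TiltDescent
open T4CubeChartExp (expPt toE continuous_expPt)
open Summit.QuantumFields.YangMills.Theorems.OrganTangentHaarFactorLipOfDwhite (haarFactor_mem_Icc)

/-! ## §1 Continuity of the chart and of the Jacobian on the window from the primitives -/

section Primitives

variable {Z : Type}

/-- ★ **THE CHART IS CONTINUOUS ON THE WINDOW** from (Φw) and the continuity of `Amin`, `Wh(·, z)` there (`expPt` and the group product are continuous; product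
topology bond by bond). [folklore] -/
theorem phi_continuousOn_of_primitives (F : T3Family) (j Ts : ℕ)
    (Φ : GaugeField (F.P j) 0 ↥(Matrix.specialUnitaryGroup (Fin 2) ℂ) × Z → GaugeField (F.P Ts) 0 ↥(Matrix.specialUnitaryGroup (Fin 2) ℂ))
    (Amin : GaugeField (F.P j) 0 ↥(Matrix.specialUnitaryGroup (Fin 2) ℂ) → GaugeField (F.P Ts) 0 ↥(Matrix.specialUnitaryGroup (Fin 2) ℂ))
    (Wh : GaugeField (F.P j) 0 ↥(Matrix.specialUnitaryGroup (Fin 2) ℂ) → Z → PBond (F.P Ts) 0 → (Fin 3 → ℝ))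
    (hΦw : ∀ V z e, Φ (V, z) e = Amin V e * expPt (Wh V z e))
    (W : Set (GaugeField (F.P j) 0 ↥(Matrix.specialUnitaryGroup (Fin 2) ℂ))) (hAmin : ContinuousOn Amin W) (hWh : ∀ z, ContinuousOn (fun V => Wh V z) W) (z : Z) :
    ContinuousOn (fun V => Φ (V, z)) W := by
  have e : (fun V => Φ (V, z)) = fun V => fun e => Amin V e * expPt (Wh V z e) := by
    funext V e; exact hΦw V z e
  rw [e]
  refine continuousOn_pi.2 fun b => ?_
  exact ((continuous_apply b).comp_continuousOn hAmin).mul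
    (continuous_expPt.comp_continuousOn ((continuous_apply b).comp_continuousOn (hWh z)))

/-- ★ **THE JACOBIAN IS CONTINUOUS ON THE WINDOW** from (Jfac), (χ-read) and the continuity of `cJ`, `Wh(·, z)` there (`sinc²∘‖toE ·‖` and finite products are continuous).
[cite: Balaban1985UV3, p.260 L25-31] -/
theorem jac_continuousOn_of_primitives (F : T3Family) (j Ts : ℕ)
    (J : GaugeField (F.P j) 0 ↥(Matrix.specialUnitaryGroup (Fin 2) ℂ) × Z → ℝ≥0) (cJ : GaugeField (F.P j) 0 ↥(Matrix.specialUnitaryGroup (Fin 2) ℂ) → ℝ)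
    (χ : GaugeField (F.P j) 0 ↥(Matrix.specialUnitaryGroup (Fin 2) ℂ) → Z → ℝ) (hJfac : ∀ V z, (J (V, z) : ℝ) = cJ V * χ V z)
    (Wh : GaugeField (F.P j) 0 ↥(Matrix.specialUnitaryGroup (Fin 2) ℂ) → Z → PBond (F.P Ts) 0 → (Fin 3 → ℝ)) (S : Finset (PBond (F.P Ts) 0))
    (hχread : ∀ V z, χ V z = ∏ e ∈ S, Real.sinc ‖toE (Wh V z e)‖ ^ 2)
    (W : Set (GaugeField (F.P j) 0 ↥(Matrix.specialUnitaryGroup (Fin 2) ℂ))) (hcJ : ContinuousOn cJ W) (hWh : ∀ z, ContinuousOn (fun V => Wh V z) W) (z : Z) :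
    ContinuousOn (fun V => (J (V, z) : ℝ)) W := by
  have e : (fun V => (J (V, z) : ℝ)) = fun V => cJ V * ∏ e ∈ S, Real.sinc ‖toE (Wh V z e)‖ ^ 2 := by
    funext V; rw [hJfac, hχread]
  rw [e]
  refine hcJ.mul (continuousOn_finsetProd S fun b _ => ?_)
  have h1 : ContinuousOn (fun V => Wh V z b) W := (continuous_apply b).comp_continuousOn (hWh z)
  have h2 : Continuous fun v : Fin 3 → ℝ => Real.sinc ‖toE v‖ ^ 2 :=
    (Real.continuous_sinc.comp (continuous_norm.comp (PiLp.continuous_toLp 2 _))).pow 2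
  exact h2.comp_continuousOn h1

end Primitives

/-! ## §2 ✓p823910's frame letters `hJle` and `hcont` -/

section Frame

variable {Z : Type}

/-- ★★ **`hJle` FROM (Jfac) + (χ-read) + A GLOBAL BOUND ON `cJ`** — ✓p823910's `hJle` text with `CJ := Cc` (`χ ∈ [0,1]` everywhere by ✓`haarFactor_mem_Icc`).
[cite: Balaban1985UV3, p.260 L25-31] -/
theorem hJle_of_primitives (F : T3Family) (j Ts : ℕ)
    (J : GaugeField (F.P j) 0 ↥(Matrix.specialUnitaryGroup (Fin 2) ℂ) × Z → ℝ≥0) (cJ : GaugeField (F.P j) 0 ↥(Matrix.specialUnitaryGroup (Fin 2) ℂ) → ℝ)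
    (χ : GaugeField (F.P j) 0 ↥(Matrix.specialUnitaryGroup (Fin 2) ℂ) → Z → ℝ) (hJfac : ∀ V z, (J (V, z) : ℝ) = cJ V * χ V z)
    (Wh : GaugeField (F.P j) 0 ↥(Matrix.specialUnitaryGroup (Fin 2) ℂ) → Z → PBond (F.P Ts) 0 → (Fin 3 → ℝ)) (S : Finset (PBond (F.P Ts) 0))
    (hχread : ∀ V z, χ V z = ∏ e ∈ S, Real.sinc ‖toE (Wh V z e)‖ ^ 2)
    (Cc : ℝ) (hcJglob : ∀ V, |cJ V| ≤ Cc) :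
    ∀ (V : GaugeField (F.P j) 0 ↥(Matrix.specialUnitaryGroup (Fin 2) ℂ)) (z : Z), (J (V, z) : ℝ) ≤ Cc := by
  intro V z
  rw [hJfac, hχread]
  have hχ := haarFactor_mem_Icc S (Wh V z)
  calc cJ V * ∏ e ∈ S, Real.sinc ‖toE (Wh V z e)‖ ^ 2
      ≤ |cJ V| * ∏ e ∈ S, Real.sinc ‖toE (Wh V z e)‖ ^ 2 := mul_le_mul_of_nonneg_right (le_abs_self _) hχ.1
    _ ≤ Cc * 1 := mul_le_mul (hcJglob V) hχ.2 hχ.1 ((abs_nonneg _).trans (hcJglob V))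
    _ = Cc := mul_one Cc

/-- ★★★ **`hcont` FROM THE D0 PRIMITIVES** — ✓p823910's `hcont` binder text VERBATIM ⟸ (Φw) + (Jfac) + (χ-read) + continuity on `{V | PlaqSmall θ_j V}` of `Amin`, `Wh(·, z)`,
`cJ` (the MW-support premise on `f` is not used). [cite: Balaban1985UV3, p.260 L25-31] -/
theorem hcont_of_primitives (F : T3Family) (γ b₀ p₀ : ℝ) (j Ts : ℕ)
    (Φ : GaugeField (F.P j) 0 ↥(Matrix.specialUnitaryGroup (Fin 2) ℂ) × Z → GaugeField (F.P Ts) 0 ↥(Matrix.specialUnitaryGroup (Fin 2) ℂ))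
    (Amin : GaugeField (F.P j) 0 ↥(Matrix.specialUnitaryGroup (Fin 2) ℂ) → GaugeField (F.P Ts) 0 ↥(Matrix.specialUnitaryGroup (Fin 2) ℂ))
    (Wh : GaugeField (F.P j) 0 ↥(Matrix.specialUnitaryGroup (Fin 2) ℂ) → Z → PBond (F.P Ts) 0 → (Fin 3 → ℝ))
    (hΦw : ∀ V z e, Φ (V, z) e = Amin V e * expPt (Wh V z e))
    (J : GaugeField (F.P j) 0 ↥(Matrix.specialUnitaryGroup (Fin 2) ℂ) × Z → ℝ≥0) (cJ : GaugeField (F.P j) 0 ↥(Matrix.specialUnitaryGroup (Fin 2) ℂ) → ℝ)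
    (χ : GaugeField (F.P j) 0 ↥(Matrix.specialUnitaryGroup (Fin 2) ℂ) → Z → ℝ) (hJfac : ∀ V z, (J (V, z) : ℝ) = cJ V * χ V z)
    (S : Finset (PBond (F.P Ts) 0)) (hχread : ∀ V z, χ V z = ∏ e ∈ S, Real.sinc ‖toE (Wh V z e)‖ ^ 2)
    (hAmin : ContinuousOn Amin {V | PlaqSmall (θBal F.L γ b₀ p₀ j) V})
    (hWh : ∀ z, ContinuousOn (fun V => Wh V z) {V | PlaqSmall (θBal F.L γ b₀ p₀ j) V})
    (hcJ : ContinuousOn cJ {V | PlaqSmall (θBal F.L γ b₀ p₀ j) V}) :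
    ∀ f : GaugeField (F.P Ts) 0 ↥(Matrix.specialUnitaryGroup (Fin 2) ℂ) → ℝ, Continuous f →
      (∀ U, f U ≠ 0 → (∀ (n : ℕ) (hjn : j + 1 ≤ n) (hnK : n ≤ Ts), PlaqSmall (24 / 25 * θBal F.L γ b₀ p₀ n) (descendTo F ℰp n Ts hnK U))) →
      ∀ z, ContinuousOn (fun V => (J (V, z) : ℝ) * f (Φ (V, z))) {V | PlaqSmall (θBal F.L γ b₀ p₀ j) V} := by
  intro f hf _ z
  exact (jac_continuousOn_of_primitives F j Ts J cJ χ hJfac Wh S hχread _ hcJ hWh z).mul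
    (hf.comp_continuousOn (phi_continuousOn_of_primitives F j Ts Φ Amin Wh hΦw _ hAmin hWh z))

end Frame

end Summit.QuantumFields.YangMills.Theorems.OrganTangentFrameLettersOfD0Primitives

end
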